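import Literature.ComputerArithmetic.Shewchuk1997.Compress
import Mathlib.Tactic.Linarith
import Mathlib.Tactic.Positivity
import Mathlib.Tactic.Ring
import Mathlib.Tactic.NormNum

/-!
# The travelling window of COMPRESS at precision 3 (new work)

New work of the certified-arithmetic venture (ENGINES group: shared numerical engines serving
client cells; rigour lives in the verifiers; every published number belongs to a client cell's
ledger, not to the engines group).  NOT a published theorem: Shewchuk [Shewchuk1997, §2.7] proves
Theorem 23 only and says nothing about iterating COMPRESS.  Precision `p = 3`, IEEE ties-to-even
`roundTiesEven 3 em`, `em ≤ 0`; lists smallest component first; every FAST-TWO-SUM is evaluated by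
[BoldoEtAl2023, §2.2] arithmetic (toolkit as in `CompressNotIdempotentPrecTwo.lean`).
* `compress_window3`: `COMPRESS⟨5, −3·2^5, −3·2^9, −3·2^12, 7·2^15⟩ = ⟨−3, −3·2^3, 7·2^6, −7·2^11,
  7·2^15⟩`, bottom carry `−3` (`compressDown_window3`); one tie is rounded (`13·2^5 ↦ 12·2^5`).
  Read at scale `2^(9j)`: the pair block `⟨5, −3·2^5⟩` below the KINK `⟨−3, −3·2^3, 7·2^6⟩·2^9`
  becomes the kink one block lower plus inert debris `⟨−7·2^11, 7·2^15⟩`.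
* `compress_kink3`, `compress_kink3_final`: `COMPRESS⟨−3, −3·2^3, 7·2^6⟩ = ⟨1, −7·2^2, 7·2^6⟩`,
  which is then fixed.
* `rne3_*`: the thirteen roundings involved, four of them making the window's neighbours INERT
  (`−91 ↦ −96`, `2464 ↦ 2560`, `−1632 ↦ −1536`, `−20032 ↦ −20480`).
With scale covariance (`CompressScaling.lean`) and locality (`CompressLocality.lean`) these drive
the family of `CompressPassesUnbounded.lean` (`2k + 4` components, exactly `k + 1` passes).
-/

namespace Summit.Ventures.CertifiedArithmetic.Expansions

open Literature.ComputerArithmetic.JeannerodRump2018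
open Literature.ComputerArithmetic.BoldoJeannerodMelquiondMuller2023 hiding twoSum twoSum_fst
open Literature.ComputerArithmetic.Shewchuk1997

variable {em : ℤ}

/-! ### Rounding toolkit -/

/-- `2^m ≤ |t| < 2^(m+1)`, `emin ≤ m − p + 1` ⟹ `ulp(t) = 2^(m−p+1)`. [cite: BoldoEtAl2023, §2.1] -/
private theorem ulp_eq_of_binade' {p : ℕ} {emin : ℤ} {t : ℚ} {m : ℤ} (hm : emin ≤ m - p + 1)
    (h1 : (2 : ℚ) ^ m ≤ |t|) (h2 : |t| < (2 : ℚ) ^ (m + 1)) :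
    ulp p emin t = (2 : ℚ) ^ (m - p + 1) := by
  have hpos : 0 < |t| := lt_of_lt_of_le (zpow_pos (by norm_num) _) h1
  have ht0 : t ≠ 0 := abs_pos.mp hpos
  have hlo : m ≤ Int.log 2 |t| :=
    (Int.zpow_le_iff_le_log (b := 2) (by norm_num) hpos).mp (by exact_mod_cast h1)
  have hhi : Int.log 2 |t| < m + 1 :=
    (Int.lt_zpow_iff_log_lt (b := 2) (by norm_num) hpos).mp (by exact_mod_cast h2)
  have hlog : Int.log 2 |t| = m := le_antisymm (by omega) hlo
  rw [ulp_of_ne_zero ht0, hlog, max_eq_right hm]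

/-- `t = (N + r)·ulp(t)` with `0 ≤ r < 1` gives `⌊t/ulp(t)⌋ = N`. [cite: BoldoEtAl2023, §2.2] -/
private theorem rne_floor' {p : ℕ} {emin : ℤ} {t U r : ℚ} {N : ℤ} (hU : ulp p emin t = U)
    (hUpos : 0 < U) (ht : t = ((N : ℚ) + r) * U) (hr0 : 0 ≤ r) (hr1 : r < 1) :
    ⌊t / ulp p emin t⌋ = N := by
  rw [hU, Int.floor_eq_iff, ht, mul_div_assoc, div_self hUpos.ne', mul_one]
  constructor <;> linarith

/-- `RN_e` below the midpoint: `r < ½` ⟹ `RN_e(t) = N·ulp(t)`. [cite: BoldoEtAl2023, §2.2] -/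
private theorem rne_down' {p : ℕ} {emin : ℤ} {t U r : ℚ} {N : ℤ} (hU : ulp p emin t = U)
    (hUpos : 0 < U) (ht : t = ((N : ℚ) + r) * U) (hr0 : 0 ≤ r) (hr1 : r < 1) (hr : r < 1 / 2) :
    roundTiesEven p emin t = (N : ℚ) * U := by
  have hfl := rne_floor' hU hUpos ht hr0 hr1
  have e1 : t - (N : ℚ) * U = r * U := by rw [ht]; ring
  have e2 : ((N : ℚ) + 1) * U - t = (1 - r) * U := by rw [ht]; ring
  have hlt : r * U < (1 - r) * U := mul_lt_mul_of_pos_right (by linarith) hUpos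
  unfold roundTiesEven
  rw [hfl, hU, e1, e2, if_pos hlt]

/-- `RN_e` above the midpoint: `r > ½` ⟹ `RN_e(t) = (N+1)·ulp(t)`. [cite: BoldoEtAl2023, §2.2] -/
private theorem rne_up' {p : ℕ} {emin : ℤ} {t U r : ℚ} {N : ℤ} (hU : ulp p emin t = U)
    (hUpos : 0 < U) (ht : t = ((N : ℚ) + r) * U) (hr0 : 0 ≤ r) (hr1 : r < 1) (hr : 1 / 2 < r) :
    roundTiesEven p emin t = ((N : ℚ) + 1) * U := by
  have hfl := rne_floor' hU hUpos ht hr0 hr1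
  have e1 : t - (N : ℚ) * U = r * U := by rw [ht]; ring
  have e2 : ((N : ℚ) + 1) * U - t = (1 - r) * U := by rw [ht]; ring
  have hgt : (1 - r) * U < r * U := mul_lt_mul_of_pos_right (by linarith) hUpos
  unfold roundTiesEven
  rw [hfl, hU, e1, e2, if_neg (not_lt.mpr hgt.le), if_pos hgt]

/-- `RN_e` AT the midpoint, even `N`: `RN_e(t) = N·ulp(t)`. [cite: BoldoEtAl2023, §2.2] -/
private theorem rne_tie_even' {p : ℕ} {emin : ℤ} {t U : ℚ} {N : ℤ} (hU : ulp p emin t = U)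
    (hUpos : 0 < U) (ht : t = ((N : ℚ) + 1 / 2) * U) (hN : Even N) :
    roundTiesEven p emin t = (N : ℚ) * U := by
  have hfl := rne_floor' hU hUpos ht (by norm_num) (by norm_num)
  have e1 : t - (N : ℚ) * U = 1 / 2 * U := by rw [ht]; ring
  have e2 : ((N : ℚ) + 1) * U - t = 1 / 2 * U := by rw [ht]; ring
  unfold roundTiesEven
  rw [hfl, hU, e1, e2, if_neg (lt_irrefl _), if_neg (lt_irrefl _), if_pos hN]

/-- FAST-TWO-SUM of floats `|b| ≤ |a|` is `(fl(a+b), a+b−fl(a+b))`. [cite: Shewchuk1997, Thm 6] -/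
private theorem f2s_eq' {p : ℕ} {emin : ℤ} {fl : ℚ → ℚ} (hp : 1 ≤ p)
    (hfl : IsRoundNearest p emin fl) {a b s : ℚ} (ha : IsFloat p emin a) (hb : IsFloat p emin b)
    (hab : |b| ≤ |a|) (hs : fl (a + b) = s) : fastTwoSum fl a b = (s, a + b - s) := by
  obtain ⟨h1, -, h2, -⟩ := fastTwoSum_exact hp hfl ha hb hab
  exact Prod.ext (by rw [h1, hs]) (by rw [h2, hs])

/-! ### The thirteen roundings (`p = 3`, `em ≤ 0`) and the floats -/

/-- `RN_e(217088) = 229376` (`ulp = 32768`, above the midpoint): the window's top absorbs the old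
kink top: `7·2^15 + (−3·2^12)`. [cite: BoldoEtAl2023, §2.2] -/
theorem rne3_217088 (he : em ≤ 0) : roundTiesEven 3 em (217088 : ℚ) = 229376 := by
  have hU : ulp 3 em (217088 : ℚ) = 32768 := by
    rw [ulp_eq_of_binade' (p := 3) (m := 17) (by omega) (by norm_num) (by norm_num)]; norm_num
  rw [rne_up' hU (by norm_num) (N := 6) (r := 5 / 8) (by norm_num) (by norm_num) (by norm_num)
    (by norm_num)]
  norm_num

/-- `RN_e(-13824) = -14336` (`ulp = 2048`, below the midpoint): `−3·2^12 + (−3·2^9)`: the new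
`−7·2^11` is born. [cite: BoldoEtAl2023, §2.2] -/
theorem rne3_m13824 (he : em ≤ 0) : roundTiesEven 3 em (-13824 : ℚ) = -14336 := by
  have hU : ulp 3 em (-13824 : ℚ) = 2048 := by
    rw [ulp_eq_of_binade' (p := 3) (m := 13) (by omega) (by norm_num) (by norm_num)]; norm_num
  rw [rne_down' hU (by norm_num) (N := -7) (r := 1 / 4) (by norm_num) (by norm_num) (by norm_num)
    (by norm_num)]
  norm_num

/-- `RN_e(416) = 384` (`ulp = 64`, exact midpoint, even side): THE TIE of the window: `2^9 +
(−3·2^5) = 13·2^5`, midpoint of `12·2^5` (even) and `14·2^5`. [cite: BoldoEtAl2023, §2.2] -/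
theorem rne3_416 (he : em ≤ 0) : roundTiesEven 3 em (416 : ℚ) = 384 := by
  have hU : ulp 3 em (416 : ℚ) = 64 := by
    rw [ulp_eq_of_binade' (p := 3) (m := 8) (by omega) (by norm_num) (by norm_num)]; norm_num
  rw [rne_tie_even' hU (by norm_num) (N := 6) (by norm_num) ⟨3, by norm_num⟩]; norm_num

/-- `RN_e(37) = 40` (`ulp = 8`, above the midpoint): `2^5 + 5`: the new kink bottom `−3 = 37 − 40`
is born. [cite: BoldoEtAl2023, §2.2] -/
theorem rne3_37 (he : em ≤ 0) : roundTiesEven 3 em (37 : ℚ) = 40 := by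
  have hU : ulp 3 em (37 : ℚ) = 8 := by
    rw [ulp_eq_of_binade' (p := 3) (m := 5) (by omega) (by norm_num) (by norm_num)]; norm_num
  rw [rne_up' hU (by norm_num) (N := 4) (r := 5 / 8) (by norm_num) (by norm_num) (by norm_num)
    (by norm_num)]
  norm_num

/-- `RN_e(424) = 448` (`ulp = 64`, above the midpoint): `384 + 40` (upward): the new kink top `448 =
7·2^6` is born; also `448 + (−24)`. [cite: BoldoEtAl2023, §2.2] -/
theorem rne3_424 (he : em ≤ 0) : roundTiesEven 3 em (424 : ℚ) = 448 := by
  have hU : ulp 3 em (424 : ℚ) = 64 := by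
    rw [ulp_eq_of_binade' (p := 3) (m := 8) (by omega) (by norm_num) (by norm_num)]; norm_num
  rw [rne_up' hU (by norm_num) (N := 6) (r := 5 / 8) (by norm_num) (by norm_num) (by norm_num)
    (by norm_num)]
  norm_num

/-- `RN_e(-13888) = -14336` (`ulp = 2048`, below the midpoint): `−7·2^11 + 448` is inert. [cite:
BoldoEtAl2023, §2.2] -/
theorem rne3_m13888 (he : em ≤ 0) : roundTiesEven 3 em (-13888 : ℚ) = -14336 := by
  have hU : ulp 3 em (-13888 : ℚ) = 2048 := by
    rw [ulp_eq_of_binade' (p := 3) (m := 13) (by omega) (by norm_num) (by norm_num)]; norm_num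
  rw [rne_down' hU (by norm_num) (N := -7) (r := 7 / 32) (by norm_num) (by norm_num) (by norm_num)
    (by norm_num)]
  norm_num

/-- `RN_e(215040) = 229376` (`ulp = 32768`, above the midpoint): `7·2^15 + (−7·2^11)` is inert.
[cite: BoldoEtAl2023, §2.2] -/
theorem rne3_215040 (he : em ≤ 0) : roundTiesEven 3 em (215040 : ℚ) = 229376 := by
  have hU : ulp 3 em (215040 : ℚ) = 32768 := by
    rw [ulp_eq_of_binade' (p := 3) (m := 17) (by omega) (by norm_num) (by norm_num)]; norm_num
  rw [rne_up' hU (by norm_num) (N := 6) (r := 9 / 16) (by norm_num) (by norm_num) (by norm_num)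
    (by norm_num)]
  norm_num

/-- `RN_e(-27) = -28` (`ulp = 4`, below the midpoint): `−24 + (−3)` in the base kink: `−28 = −7·2^2`
is born; also `−28 + 1` is inert. [cite: BoldoEtAl2023, §2.2] -/
theorem rne3_m27 (he : em ≤ 0) : roundTiesEven 3 em (-27 : ℚ) = -28 := by
  have hU : ulp 3 em (-27 : ℚ) = 4 := by
    rw [ulp_eq_of_binade' (p := 3) (m := 4) (by omega) (by norm_num) (by norm_num)]; norm_num
  rw [rne_down' hU (by norm_num) (N := -7) (r := 1 / 4) (by norm_num) (by norm_num) (by norm_num)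
    (by norm_num)]
  norm_num

/-- `RN_e(420) = 448` (`ulp = 64`, above the midpoint): `448 + (−28)` is inert. [cite:
BoldoEtAl2023, §2.2] -/
theorem rne3_420 (he : em ≤ 0) : roundTiesEven 3 em (420 : ℚ) = 448 := by
  have hU : ulp 3 em (420 : ℚ) = 64 := by
    rw [ulp_eq_of_binade' (p := 3) (m := 8) (by omega) (by norm_num) (by norm_num)]; norm_num
  rw [rne_up' hU (by norm_num) (N := 6) (r := 9 / 16) (by norm_num) (by norm_num) (by norm_num)
    (by norm_num)]
  norm_num

/-- `RN_e(-91) = -96` (`ulp = 16`, below the midpoint): a pair block is inert: `−3·2^5 + 5`. [cite: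
BoldoEtAl2023, §2.2] -/
theorem rne3_m91 (he : em ≤ 0) : roundTiesEven 3 em (-91 : ℚ) = -96 := by
  have hU : ulp 3 em (-91 : ℚ) = 16 := by
    rw [ulp_eq_of_binade' (p := 3) (m := 6) (by omega) (by norm_num) (by norm_num)]; norm_num
  rw [rne_down' hU (by norm_num) (N := -6) (r := 5 / 16) (by norm_num) (by norm_num) (by norm_num)
    (by norm_num)]
  norm_num

/-- `RN_e(2464) = 2560` (`ulp = 512`, above the midpoint): consecutive pair blocks are inert: `5·2^9
+ (−3·2^5)`. [cite: BoldoEtAl2023, §2.2] -/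
theorem rne3_2464 (he : em ≤ 0) : roundTiesEven 3 em (2464 : ℚ) = 2560 := by
  have hU : ulp 3 em (2464 : ℚ) = 512 := by
    rw [ulp_eq_of_binade' (p := 3) (m := 11) (by omega) (by norm_num) (by norm_num)]; norm_num
  rw [rne_up' hU (by norm_num) (N := 4) (r := 13 / 16) (by norm_num) (by norm_num) (by norm_num)
    (by norm_num)]
  norm_num

/-- `RN_e(-1632) = -1536` (`ulp = 256`, above the midpoint): the kink's bottom `−3·2^9` is INERT
above the top `−3·2^5` of the last pair block. [cite: BoldoEtAl2023, §2.2] -/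
theorem rne3_m1632 (he : em ≤ 0) : roundTiesEven 3 em (-1632 : ℚ) = -1536 := by
  have hU : ulp 3 em (-1632 : ℚ) = 256 := by
    rw [ulp_eq_of_binade' (p := 3) (m := 10) (by omega) (by norm_num) (by norm_num)]; norm_num
  rw [rne_up' hU (by norm_num) (N := -7) (r := 5 / 8) (by norm_num) (by norm_num) (by norm_num)
    (by norm_num)]
  norm_num

/-- `RN_e(-20032) = -20480` (`ulp = 4096`, below the midpoint): the family's summit `−5·2^12` is
INERT above a kink top `7·2^6`. [cite: BoldoEtAl2023, §2.2] -/
theorem rne3_m20032 (he : em ≤ 0) : roundTiesEven 3 em (-20032 : ℚ) = -20480 := by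
  have hU : ulp 3 em (-20032 : ℚ) = 4096 := by
    rw [ulp_eq_of_binade' (p := 3) (m := 14) (by omega) (by norm_num) (by norm_num)]; norm_num
  rw [rne_down' hU (by norm_num) (N := -5) (r := 7 / 64) (by norm_num) (by norm_num) (by norm_num)
    (by norm_num)]
  norm_num

/-- The floats met in the window and the kink (`p = 3`, `em ≤ 0`).
[cite: JeannerodRump2018, §1 (the set F)] -/
theorem window3_isFloat (he : em ≤ 0) :
    IsFloat 3 em (229376 : ℚ) ∧ IsFloat 3 em (-12288 : ℚ) ∧ IsFloat 3 em (-1536 : ℚ) ∧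
      IsFloat 3 em (-96 : ℚ) ∧ IsFloat 3 em (5 : ℚ) ∧ IsFloat 3 em (512 : ℚ) ∧
      IsFloat 3 em (32 : ℚ) ∧ IsFloat 3 em (-14336 : ℚ) ∧ IsFloat 3 em (384 : ℚ) ∧
      IsFloat 3 em (40 : ℚ) ∧ IsFloat 3 em (-3 : ℚ) ∧ IsFloat 3 em (448 : ℚ) ∧
      IsFloat 3 em (-24 : ℚ) ∧ IsFloat 3 em (-28 : ℚ) ∧ IsFloat 3 em (1 : ℚ) :=
  ⟨⟨7, 15, by norm_num, by omega, by norm_num⟩, ⟨-3, 12, by norm_num, by omega, by norm_num⟩,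
    ⟨-3, 9, by norm_num, by omega, by norm_num⟩, ⟨-3, 5, by norm_num, by omega, by norm_num⟩,
    ⟨5, 0, by norm_num, he, by norm_num⟩, ⟨4, 7, by norm_num, by omega, by norm_num⟩,
    ⟨4, 3, by norm_num, by omega, by norm_num⟩, ⟨-7, 11, by norm_num, by omega, by norm_num⟩,
    ⟨6, 6, by norm_num, by omega, by norm_num⟩, ⟨5, 3, by norm_num, by omega, by norm_num⟩,
    ⟨-3, 0, by norm_num, he, by norm_num⟩, ⟨7, 6, by norm_num, by omega, by norm_num⟩,
    ⟨-3, 3, by norm_num, by omega, by norm_num⟩, ⟨-7, 2, by norm_num, by omega, by norm_num⟩,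
    ⟨1, 0, by norm_num, he, by norm_num⟩⟩

/-! ### The window -/

section window
variable (he : em ≤ 0)
include he

/-- The eight FAST-TWO-SUMs of the window pass: downward `(7·2^15, −3·2^12) ↦` inert,
`(−3·2^12, −3·2^9) ↦ (−7·2^11, 2^9)`, `(2^9, −3·2^5) ↦ (3·2^7, 2^5)` [the tie],
`(2^5, 5) ↦ (40, −3)`;
upward `(40, −3) ↦` inert, `(384, 40) ↦ (448, −24)`, `(−7·2^11, 448) ↦` inert, `(7·2^15, −7·2^11) ↦`
inert. [cite: Shewchuk1997, §2.3 Theorem 6; BoldoEtAl2023, §2.2] -/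
theorem window3_fastTwoSum :
    fastTwoSum (roundTiesEven 3 em) 229376 (-12288) = (229376, -12288) ∧
      fastTwoSum (roundTiesEven 3 em) (-12288) (-1536) = (-14336, 512) ∧
      fastTwoSum (roundTiesEven 3 em) 512 (-96) = (384, 32) ∧
      fastTwoSum (roundTiesEven 3 em) 32 5 = (40, -3) ∧
      fastTwoSum (roundTiesEven 3 em) 40 (-3) = (40, -3) ∧
      fastTwoSum (roundTiesEven 3 em) 384 40 = (448, -24) ∧
      fastTwoSum (roundTiesEven 3 em) (-14336) 448 = (-14336, 448) ∧
      fastTwoSum (roundTiesEven 3 em) 229376 (-14336) = (229376, -14336) := by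
  have hfl := isRoundNearest_roundTiesEven (p := 3) (emin := em) (by norm_num)
  obtain ⟨f229376, f12288, f1536, f96, f5, f512, f32, f14336, f384, f40, f3, f448, -, -, -⟩ :=
    window3_isFloat he
  refine ⟨?_, ?_, ?_, ?_, ?_, ?_, ?_, ?_⟩
  · rw [f2s_eq' (by norm_num) (s := 229376) hfl f229376 f12288 (by norm_num)
      (by rw [show (229376 : ℚ) + -12288 = 217088 by norm_num]; exact rne3_217088 he)]
    norm_num
  · rw [f2s_eq' (by norm_num) (s := -14336) hfl f12288 f1536 (by norm_num)
      (by rw [show (-12288 : ℚ) + -1536 = -13824 by norm_num]; exact rne3_m13824 he)]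
    norm_num
  · rw [f2s_eq' (by norm_num) (s := 384) hfl f512 f96 (by norm_num)
      (by rw [show (512 : ℚ) + -96 = 416 by norm_num]; exact rne3_416 he)]
    norm_num
  · rw [f2s_eq' (by norm_num) (s := 40) hfl f32 f5 (by norm_num)
      (by rw [show (32 : ℚ) + 5 = 37 by norm_num]; exact rne3_37 he)]
    norm_num
  · rw [f2s_eq' (by norm_num) (s := 40) hfl f40 f3 (by norm_num)
      (by rw [show (40 : ℚ) + -3 = 37 by norm_num]; exact rne3_37 he)]
    norm_num
  · rw [f2s_eq' (by norm_num) (s := 448) hfl f384 f40 (by norm_num)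
      (by rw [show (384 : ℚ) + 40 = 424 by norm_num]; exact rne3_424 he)]
    norm_num
  · rw [f2s_eq' (by norm_num) (s := -14336) hfl f14336 f448 (by norm_num)
      (by rw [show (-14336 : ℚ) + 448 = -13888 by norm_num]; exact rne3_m13888 he)]
    norm_num
  · rw [f2s_eq' (by norm_num) (s := 229376) hfl f229376 f14336 (by norm_num)
      (by rw [show (229376 : ℚ) + -14336 = 215040 by norm_num]; exact rne3_215040 he)]
    norm_num

/-- The downward sweep of the window: from `Q = 7·2^15` over `−3·2^12, −3·2^9, −3·2^5, 5` it emits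
`7·2^15, −7·2^11, 3·2^7, 40` and ends with the carry `−3`.
[cite: Shewchuk1997, §2.7 p. 332 (COMPRESS), Lines 1–9] -/
theorem compressDown_window3 :
    compressDown (roundTiesEven 3 em) 229376 [-12288, -1536, -96, 5] =
      ([229376, -14336, 384, 40], -3) := by
  obtain ⟨F1, F2, F3, F4, -, -, -, -⟩ := window3_fastTwoSum he
  rw [compressDown_cons_of_ne_zero (by rw [F1]; norm_num), F1]
  simp only
  rw [compressDown_cons_of_ne_zero (by rw [F2]; norm_num), F2]
  simp only
  rw [compressDown_cons_of_ne_zero (by rw [F3]; norm_num), F3]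
  simp only
  rw [compressDown_cons_of_ne_zero (by rw [F4]; norm_num), F4]
  simp

/-- **The window pass**: `COMPRESS⟨5, −3·2^5, −3·2^9, −3·2^12, 7·2^15⟩ =
⟨−3, −3·2^3, 7·2^6, −7·2^11, 7·2^15⟩` (`p = 3`, ties-to-even, `em ≤ 0`).
[cite: Shewchuk1997, §2.7 p. 332 (COMPRESS)] -/
theorem compress_window3 :
    compress (roundTiesEven 3 em) [5, -96, -1536, -12288, 229376] =
      [-3, -24, 448, -14336, 229376] := by
  obtain ⟨-, -, -, -, U1, U2, U3, U4⟩ := window3_fastTwoSum he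
  have hc : compress (roundTiesEven 3 em) [5, -96, -1536, -12288, 229376] =
      compressUp (roundTiesEven 3 em) (-3) [40, 384, -14336, 229376] := by
    simp only [compress, List.reverse_cons, List.reverse_nil, List.nil_append, List.cons_append,
      compressDown_window3 he]
  rw [hc, compressUp_cons_of_ne_zero (by rw [U1]; norm_num), U1]
  simp only
  rw [compressUp_cons_of_ne_zero (by rw [U2]; norm_num), U2]
  simp only
  rw [compressUp_cons_of_ne_zero (by rw [U3]; norm_num), U3]
  simp only
  rw [compressUp_cons_of_ne_zero (by rw [U4]; norm_num), U4]
  simp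

end window

/-! ### The kink's last step -/

section kink
variable (he : em ≤ 0)
include he

/-- The four FAST-TWO-SUMs of the last step: downward `(448, −24) ↦` inert, `(−24, −3) ↦ (−28, 1)`;
upward `(−28, 1) ↦` inert, `(448, −28) ↦` inert.
[cite: Shewchuk1997, §2.3 Theorem 6; BoldoEtAl2023, §2.2] -/
theorem kink3_fastTwoSum :
    fastTwoSum (roundTiesEven 3 em) 448 (-24) = (448, -24) ∧
      fastTwoSum (roundTiesEven 3 em) (-24) (-3) = (-28, 1) ∧
      fastTwoSum (roundTiesEven 3 em) (-28) 1 = (-28, 1) ∧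
      fastTwoSum (roundTiesEven 3 em) 448 (-28) = (448, -28) := by
  have hfl := isRoundNearest_roundTiesEven (p := 3) (emin := em) (by norm_num)
  obtain ⟨-, -, -, -, -, -, -, -, -, -, f3, f448, f24, f28, f1⟩ := window3_isFloat he
  refine ⟨?_, ?_, ?_, ?_⟩
  · rw [f2s_eq' (by norm_num) (s := 448) hfl f448 f24 (by norm_num)
      (by rw [show (448 : ℚ) + -24 = 424 by norm_num]; exact rne3_424 he)]
    norm_num
  · rw [f2s_eq' (by norm_num) (s := -28) hfl f24 f3 (by norm_num)
      (by rw [show (-24 : ℚ) + -3 = -27 by norm_num]; exact rne3_m27 he)]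
    norm_num
  · rw [f2s_eq' (by norm_num) (s := -28) hfl f28 f1 (by norm_num)
      (by rw [show (-28 : ℚ) + 1 = -27 by norm_num]; exact rne3_m27 he)]
    norm_num
  · rw [f2s_eq' (by norm_num) (s := 448) hfl f448 f28 (by norm_num)
      (by rw [show (448 : ℚ) + -28 = 420 by norm_num]; exact rne3_420 he)]
    norm_num

/-- The downward sweep of the last step ends with the carry `1`.
[cite: Shewchuk1997, §2.7 p. 332 (COMPRESS), Lines 1–9] -/
theorem compressDown_kink3 :
    compressDown (roundTiesEven 3 em) 448 [-24, -3] = ([448, -28], 1) := by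
  obtain ⟨F1, F2, -, -⟩ := kink3_fastTwoSum he
  rw [compressDown_cons_of_ne_zero (by rw [F1]; norm_num), F1]
  simp only
  rw [compressDown_cons_of_ne_zero (by rw [F2]; norm_num), F2]
  simp

/-- **The last step**: `COMPRESS⟨−3, −3·2^3, 7·2^6⟩ = ⟨1, −7·2^2, 7·2^6⟩` (`p = 3`, ties-to-even,
`em ≤ 0`). [cite: Shewchuk1997, §2.7 p. 332 (COMPRESS)] -/
theorem compress_kink3 : compress (roundTiesEven 3 em) [-3, -24, 448] = [1, -28, 448] := by
  obtain ⟨-, -, U1, U2⟩ := kink3_fastTwoSum he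
  have hc : compress (roundTiesEven 3 em) [-3, -24, 448] =
      compressUp (roundTiesEven 3 em) 1 [-28, 448] := by
    simp only [compress, List.reverse_cons, List.reverse_nil, List.nil_append, List.cons_append,
      compressDown_kink3 he]
  rw [hc, compressUp_cons_of_ne_zero (by rw [U1]; norm_num), U1]
  simp only
  rw [compressUp_cons_of_ne_zero (by rw [U2]; norm_num), U2]
  simp

/-- … and `⟨1, −7·2^2, 7·2^6⟩` is then fixed. [cite: Shewchuk1997, §2.7 p. 332 (COMPRESS)] -/
theorem compress_kink3_final : compress (roundTiesEven 3 em) [1, -28, 448] = [1, -28, 448] := by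
  obtain ⟨-, -, U1, U2⟩ := kink3_fastTwoSum he
  have hD : compressDown (roundTiesEven 3 em) 448 [-28, 1] = ([448, -28], 1) := by
    rw [compressDown_cons_of_ne_zero (by rw [U2]; norm_num), U2]
    simp only
    rw [compressDown_cons_of_ne_zero (by rw [U1]; norm_num), U1]
    simp
  have hc : compress (roundTiesEven 3 em) [1, -28, 448] =
      compressUp (roundTiesEven 3 em) 1 [-28, 448] := by
    simp only [compress, List.reverse_cons, List.reverse_nil, List.nil_append, List.cons_append,
      hD]
  rw [hc, compressUp_cons_of_ne_zero (by rw [U1]; norm_num), U1]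
  simp only
  rw [compressUp_cons_of_ne_zero (by rw [U2]; norm_num), U2]
  simp

end kink

end Summit.Ventures.CertifiedArithmetic.Expansions
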